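import Literature.MathematicalPhysics.QuantumFieldTheory.Balaban1983to89.Node00.TwoRunSiteBlockAnimals

/-!
# NODE 00 — BLOCKS ARE CONNECTED, SO COMPONENTS AND THE FORGIVING WINDOW KEEP BLOCK-SATURATION: two finest sites with the same `ℓ`-fold block point are joined by a chain of
# touching sites inside their block; hence a `SiteTouch`-component of an `ℓ`-block-saturated region is `ℓ`-block-saturated, and so is the complement of the forgiven hole
# `forgive SiteTouch R Λ` whenever `Λᶜ` is — the component-wise forgiving window `forgiveKeyComp` keeps the saturation of every large-field region

Cell `pub-ymgap`, YM-PLAN Track A (HUMAN RULING D-0062; width push D-0149); seat `pub-ymgap-dag-n20-d` (R134 (a) N20 NE7b s3) gen 33 — companion of `Node00/TwoRunSiteBlockAnimals`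
(gen 33: `iterBlockOf_apply_eq_natCast`, `iterBlock_subset_of_mem_image`, `blockSaturated_compl`, the saturation hypothesis SHAPE `∀ x x', iterBlockOf ℓ x = iterBlockOf ℓ x' → x ∈ Z → x' ∈ Z`)
and of `Node00/TwoRunSiteComponents` (`ConnIn`, `compIn`, `absorbed`, `forgive`, `forgiveKeyComp`).  [LF-II] = [Balaban1989LargeFieldII]; [III] = [Balaban1988Convergent].
WHY.  The block-grain Peierls road (`Summits/…/BalabanUVNodesSpineReadingOfRecord13CoPHKComponentSizeBlocks{,Inside,Window}`) reads its INSIDE energy letters off coarse classes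
whose level-`j` large-field regions must be `ℓ`-block-saturated; at the identity and level-window readings this follows from the cubes of record (`blockSaturated_seq_Λ_compl`).
The K-kit's COMPONENT-WISE FORGIVING reading (`forgiveKeyCompSigma`, `Summits/…CoPHKForgive.forgiveCompReading₁₃`) replaces each small-field entry `Λ_j` by
`forgive SiteTouch R Λ_j = Λ_j ∪ absorbed R Λ_jᶜ` (the components of the hole meeting the floor region are filled), so its large-field region is a UNION OF COMPONENTS of `Λ_jᶜ`;
saturation survives iff components of saturated regions are saturated, which rests on ONE geometric fact: a block `B^ℓ(y)` of the torus is `SiteTouch`-connected.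
WHAT IS HERE.  §1 ★ `connIn_iterBlock_of_iterBlockOf_eq` (two sites with the same `ℓ`-fold block point are `ConnIn SiteTouch` inside their block: induction on the label distance,
one coordinate moved by one unit per step, the block label unchanged because the moving label stays between two labels of the same block — `siteTouch_update_add_one ∕ _sub_one`,
`div_eq_of_between`); §2 ★ `blockSaturated_compIn` (components of saturated regions are saturated), `blockSaturated_compl_forgive` (the forgiven hole's complement), ★
`blockSaturated_compl_forgiveKeyComp_snd` (every large-field region of the component-wise forgiving window of a key whose regions are saturated).
HONEST — WHAT THIS IS NOT.  Finite torus geometry (theorems only, 0 `def`); NO weight, NO measure, NO estimate; nothing of Bałaban's asserted; NE7 ∕ NE7b ∕ NE7c NOT PRINTED for `d = 4`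
and NOT proved; no node count moves (typed 28∕28 · discharged 8∕27); no `sorry`, no `axiom`, no `instance`, no `notation`; one finite four-torus programme at fixed `ε` — NOT ℝ⁴,
NOT OS, NOT a mass gap, NOT the Clay problem.
-/

noncomputable section

open scoped BigOperators

namespace Literature.MathematicalPhysics.QuantumFieldTheory.Balaban1983to89.Node00

open T4Continuum B5Eq118OneStroke

/-! ## §1  Blocks are `SiteTouch`-connected -/

section Connected

variable {P : Params} {j : ℕ}

/-- Moving one coordinate up by one unit is a touching step. [cite: Balaban1989LargeFieldII, (1.84) p.386 (bookkeeping)] -/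
theorem siteTouch_update_add_one (x : Site P j) (μ : Fin P.d) : SiteTouch x (Function.update x μ (x μ + 1)) := by
  intro ν
  by_cases h : ν = μ
  · subst h
    right; left
    rw [Function.update_self, add_sub_cancel_left]
  · left
    rw [Function.update_of_ne h, sub_self]

/-- Moving one coordinate down by one unit is a touching step. [cite: Balaban1989LargeFieldII, (1.84) p.386 (bookkeeping)] -/
theorem siteTouch_update_sub_one (x : Site P j) (μ : Fin P.d) : SiteTouch x (Function.update x μ (x μ - 1)) := by
  intro ν
  by_cases h : ν = μ
  · subst h
    right; right
    rw [Function.update_self, sub_sub_cancel_left]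
  · left
    rw [Function.update_of_ne h, sub_self]

/-- [folklore] A natural number squeezed between two numbers with the same quotient has that quotient. [cite: Balaban1984PropagatorsI, (1.6) p.18 (bookkeeping)] -/
theorem div_eq_of_between {q a b c : ℕ} (hab : a ≤ b) (hbc : b ≤ c) (h : a / q = c / q) : b / q = a / q :=
  le_antisymm (h ▸ Nat.div_le_div_right hbc) (Nat.div_le_div_right hab)

variable {ℓ : ℕ}

/-- One step of the chain: from `x ≠ x'` in the same `ℓ`-block, a touching neighbour `x₁` of `x` in the same block, strictly closer to `x'` in label distance.
[cite: Balaban1984PropagatorsI, (1.18) p.20 (bookkeeping)] -/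
theorem exists_step_in_iterBlock (hℓ : ℓ ≤ P.m + P.K) {x x' : Site P 0} (hb : iterBlockOf ℓ x = iterBlockOf ℓ x') (hne : x ≠ x') :
    ∃ x₁ : Site P 0, SiteTouch x x₁ ∧ iterBlockOf ℓ x₁ = iterBlockOf ℓ x ∧
      ∑ ν, ((x₁ ν).val - (x' ν).val + ((x' ν).val - (x₁ ν).val)) < ∑ ν, ((x ν).val - (x' ν).val + ((x' ν).val - (x ν).val)) := by
  -- a coordinate where the labels differ
  have hμ : ∃ μ, (x μ).val ≠ (x' μ).val := by
    by_contra hall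
    exact hne (funext fun ν => ZMod.val_injective _ (not_not.1 fun hν => hall ⟨ν, hν⟩))
  obtain ⟨μ, hμ⟩ := hμ
  have hbμ : (x μ).val / P.L ^ ℓ = (x' μ).val / P.L ^ ℓ := by
    rw [← val_iterBlockOf ℓ hℓ x μ, ← val_iterBlockOf ℓ hℓ x' μ, hb]
  -- the distance summand at `μ` and away from `μ`
  have hsplit : ∀ y : Site P 0, ∑ ν, ((y ν).val - (x' ν).val + ((x' ν).val - (y ν).val)) =
      ((y μ).val - (x' μ).val + ((x' μ).val - (y μ).val)) + ∑ ν ∈ Finset.univ.erase μ, ((y ν).val - (x' ν).val + ((x' ν).val - (y ν).val)) :=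
    fun y => (Finset.add_sum_erase Finset.univ (fun ν => (y ν).val - (x' ν).val + ((x' ν).val - (y ν).val)) (Finset.mem_univ μ)).symm
  rcases lt_or_gt_of_ne hμ with hlt | hgt
  · -- move up: `x₁ μ = x μ + 1`
    refine ⟨Function.update x μ (x μ + 1), siteTouch_update_add_one x μ, ?_, ?_⟩
    · have hval : (x μ + 1).val = (x μ).val + 1 := by
        rw [ZMod.val_add_of_lt, ZMod.val_one]
        · rw [ZMod.val_one]; exact lt_of_le_of_lt (Nat.succ_le_of_lt hlt) (ZMod.val_lt (x' μ))
      funext ν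
      by_cases h : ν = μ
      · rw [h, iterBlockOf_apply_eq_natCast hℓ, iterBlockOf_apply_eq_natCast hℓ, Function.update_self, hval,
          div_eq_of_between (Nat.le_succ _) (Nat.succ_le_of_lt hlt) hbμ]
      · rw [iterBlockOf_apply_eq_natCast hℓ, iterBlockOf_apply_eq_natCast hℓ, Function.update_of_ne h]
    · rw [hsplit, hsplit x, Function.update_self]
      have hrest : ∑ ν ∈ Finset.univ.erase μ, (((Function.update x μ (x μ + 1)) ν).val - (x' ν).val + ((x' ν).val - ((Function.update x μ (x μ + 1)) ν).val)) =
          ∑ ν ∈ Finset.univ.erase μ, ((x ν).val - (x' ν).val + ((x' ν).val - (x ν).val)) :=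
        Finset.sum_congr rfl fun ν hν => by rw [Function.update_of_ne (Finset.ne_of_mem_erase hν)]
      rw [hrest]
      have hval : (x μ + 1).val = (x μ).val + 1 := by
        rw [ZMod.val_add_of_lt, ZMod.val_one]
        · rw [ZMod.val_one]; exact lt_of_le_of_lt (Nat.succ_le_of_lt hlt) (ZMod.val_lt (x' μ))
      rw [hval]
      omega
  · -- move down: `x₁ μ = x μ − 1`
    refine ⟨Function.update x μ (x μ - 1), siteTouch_update_sub_one x μ, ?_, ?_⟩
    · have hval : (x μ - 1).val = (x μ).val - 1 := by
        rw [ZMod.val_sub, ZMod.val_one]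
        rw [ZMod.val_one]; omega
      funext ν
      by_cases h : ν = μ
      · rw [h, iterBlockOf_apply_eq_natCast hℓ, iterBlockOf_apply_eq_natCast hℓ, Function.update_self, hval]
        have h1 : (x' μ).val ≤ (x μ).val - 1 := Nat.le_sub_one_of_lt hgt
        have h2 : (x μ).val - 1 ≤ (x μ).val := Nat.sub_le _ _
        rw [div_eq_of_between h1 h2 hbμ.symm, hbμ]
      · rw [iterBlockOf_apply_eq_natCast hℓ, iterBlockOf_apply_eq_natCast hℓ, Function.update_of_ne h]
    · rw [hsplit, hsplit x, Function.update_self]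
      have hrest : ∑ ν ∈ Finset.univ.erase μ, (((Function.update x μ (x μ - 1)) ν).val - (x' ν).val + ((x' ν).val - ((Function.update x μ (x μ - 1)) ν).val)) =
          ∑ ν ∈ Finset.univ.erase μ, ((x ν).val - (x' ν).val + ((x' ν).val - (x ν).val)) :=
        Finset.sum_congr rfl fun ν hν => by rw [Function.update_of_ne (Finset.ne_of_mem_erase hν)]
      rw [hrest]
      have hval : (x μ - 1).val = (x μ).val - 1 := by
        rw [ZMod.val_sub, ZMod.val_one]
        rw [ZMod.val_one]; omega
      rw [hval]
      omega

/-- ★ **BLOCKS ARE CONNECTED**: two finest sites with the same `ℓ`-fold block point are joined by a chain of touching sites INSIDE their block `B^ℓ` (standing range `ℓ ≤ m + K`).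
[cite: Balaban1984PropagatorsI, (1.18) p.20 (bookkeeping)] -/
theorem connIn_iterBlock_of_iterBlockOf_eq (hℓ : ℓ ≤ P.m + P.K) {x x' : Site P 0} (hb : iterBlockOf ℓ x = iterBlockOf ℓ x') :
    ConnIn SiteTouch (↑(iterBlock ℓ (iterBlockOf ℓ x')) : Set (Site P 0)) x x' := by
  -- induction on the label distance
  suffices h : ∀ (D : ℕ) (y : Site P 0), iterBlockOf ℓ y = iterBlockOf ℓ x' →
      ∑ ν, ((y ν).val - (x' ν).val + ((x' ν).val - (y ν).val)) ≤ D → ConnIn SiteTouch (↑(iterBlock ℓ (iterBlockOf ℓ x')) : Set (Site P 0)) y x' from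
    h _ x hb le_rfl
  intro D
  induction D with
  | zero =>
    intro y hy hD
    have hyx : y = x' := by
      funext ν
      have h0 := Finset.sum_eq_zero_iff.1 (Nat.le_zero.1 hD) ν (Finset.mem_univ ν)
      exact ZMod.val_injective _ (by omega)
    rw [hyx]
    exact connIn_refl SiteTouch _ _
  | succ D ih =>
    intro y hy hD
    by_cases hne : y = x'
    · rw [hne]; exact connIn_refl SiteTouch _ _
    · obtain ⟨y₁, htouch, hy₁, hlt⟩ := exists_step_in_iterBlock hℓ hy hne
      have hy₁' : iterBlockOf ℓ y₁ = iterBlockOf ℓ x' := hy₁.trans hy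
      have hmemy : y ∈ (↑(iterBlock ℓ (iterBlockOf ℓ x')) : Set (Site P 0)) := by
        rw [Finset.mem_coe, mem_iterBlock]; exact hy
      have hmemy₁ : y₁ ∈ (↑(iterBlock ℓ (iterBlockOf ℓ x')) : Set (Site P 0)) := by
        rw [Finset.mem_coe, mem_iterBlock]; exact hy₁'
      exact Relation.ReflTransGen.head ⟨hmemy, hmemy₁, htouch⟩ (ih y₁ hy₁' (by omega))

/-- … hence inside any region containing that block. [cite: Balaban1984PropagatorsI, (1.18) p.20 (bookkeeping)] -/
theorem connIn_of_iterBlockOf_eq_of_iterBlock_subset (hℓ : ℓ ≤ P.m + P.K) {Z : Set (Site P 0)} {x x' : Site P 0} (hb : iterBlockOf ℓ x = iterBlockOf ℓ x')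
    (hZ : (↑(iterBlock ℓ (iterBlockOf ℓ x')) : Set (Site P 0)) ⊆ Z) : ConnIn SiteTouch Z x x' :=
  (connIn_iterBlock_of_iterBlockOf_eq hℓ hb).mono SiteTouch hZ

end Connected

/-! ## §2  Components and the forgiving window keep block-saturation -/

section Saturation

variable {P : Params} {ℓ : ℕ}

/-- ★ **A COMPONENT OF A BLOCK-SATURATED REGION IS BLOCK-SATURATED** (the component through a point OF the region). [cite: Balaban1989LargeFieldII, (1.84) p.386 (bookkeeping)] -/
theorem blockSaturated_compIn (hℓ : ℓ ≤ P.m + P.K) {Z : Set (Site P 0)} (hsat : ∀ ⦃x x' : Site P 0⦄, iterBlockOf ℓ x = iterBlockOf ℓ x' → x ∈ Z → x' ∈ Z)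
    {z : Site P 0} (hz : z ∈ Z) :
    ∀ ⦃x x' : Site P 0⦄, iterBlockOf ℓ x = iterBlockOf ℓ x' → x ∈ compIn SiteTouch Z z → x' ∈ compIn SiteTouch Z z := by
  intro x x' hxx hx
  have hxZ : x ∈ Z := compIn_subset SiteTouch hz hx
  have hblk : (↑(iterBlock ℓ (iterBlockOf ℓ x')) : Set (Site P 0)) ⊆ Z :=
    iterBlock_subset_of_mem_image hsat ⟨x, hxZ, hxx⟩
  exact mem_compIn_of_connIn SiteTouch hx (connIn_of_iterBlockOf_eq_of_iterBlock_subset hℓ hxx hblk)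

/-- **THE COMPLEMENT OF THE FORGIVEN HOLE IS BLOCK-SATURATED** when the hole's complement region `Λᶜ` is: `(forgive SiteTouch R Λ)ᶜ` is `Λᶜ` minus the components of `Λᶜ`
meeting `R`, and a saturated component cannot contain one of two block-mates without the other (any reference region `R`). [cite: Balaban1989LargeFieldII, (1.85) p.386 (bookkeeping)] -/
theorem blockSaturated_compl_forgive (hℓ : ℓ ≤ P.m + P.K) (R : Set (Site P 0)) {Λ : Set (Site P 0)}
    (hsat : ∀ ⦃x x' : Site P 0⦄, iterBlockOf ℓ x = iterBlockOf ℓ x' → x ∈ Λᶜ → x' ∈ Λᶜ) :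
    ∀ ⦃x x' : Site P 0⦄, iterBlockOf ℓ x = iterBlockOf ℓ x' → x ∈ (forgive SiteTouch R Λ)ᶜ → x' ∈ (forgive SiteTouch R Λ)ᶜ := by
  intro x x' hxx hx hx'
  rw [Set.mem_compl_iff, mem_forgive_iff, not_or] at hx
  have hx'Λ : x' ∈ Λᶜ := hsat hxx hx.1
  rcases (mem_forgive_iff SiteTouch R Λ x').1 hx' with h | h
  · exact hx'Λ h
  · obtain ⟨z₀, hz₀, hz₀R, hc⟩ := (mem_absorbed_iff_exists_compIn SiteTouch R Λᶜ x').1 h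
    have hxc : x ∈ compIn SiteTouch Λᶜ z₀ := blockSaturated_compIn hℓ hsat hz₀ hxx.symm hc
    exact hx.2 ((mem_absorbed_iff_exists_compIn SiteTouch R Λᶜ x).2 ⟨z₀, hz₀, hz₀R, hxc⟩)

variable (F : T4Family) {Kc : ℕ}

/-- ★ **THE COMPONENT-WISE FORGIVING WINDOW KEEPS THE SATURATION OF EVERY LARGE-FIELD REGION**: if all regions `(x.2 j)ᶜ` of a key are `ℓ`-block-saturated (any floor `c`; the
floor region is one of them or `∅`), so is every region `((forgiveKeyComp F c x).2 j)ᶜ` — `∅` at the forgotten levels, a forgiven hole's complement at the kept ones.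
[cite: Balaban1989LargeFieldII, (1.85) p.386 (bookkeeping)] -/
theorem blockSaturated_compl_forgiveKeyComp_snd (hℓ : ℓ ≤ (F.P Kc).m + (F.P Kc).K) (c j : ℕ) (x : SiteSeqKey F Kc)
    (hx : ∀ ⦃z z' : Site (F.P Kc) 0⦄, iterBlockOf ℓ z = iterBlockOf ℓ z' → z ∈ (x.2 j)ᶜ → z' ∈ (x.2 j)ᶜ) :
    ∀ ⦃z z' : Site (F.P Kc) 0⦄, iterBlockOf ℓ z = iterBlockOf ℓ z' → z ∈ ((forgiveKeyComp F c x).2 j)ᶜ → z' ∈ ((forgiveKeyComp F c x).2 j)ᶜ := by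
  intro z z' hzz hz
  unfold forgiveKeyComp at hz ⊢
  simp only at hz ⊢
  by_cases h : 1 ≤ j ∧ j ≤ c
  · rw [if_pos h] at hz
    exact absurd (Set.mem_univ z) hz
  · rw [if_neg h] at hz ⊢
    exact blockSaturated_compl_forgive hℓ _ hx hzz hz

end Saturation

end Literature.MathematicalPhysics.QuantumFieldTheory.Balaban1983to89.Node00

end
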